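import Summits.HubbardSuperconductivity.HubbardSuperconductivity.Theorems.BirGroundStateAverageLRO.Negative.RegimeMap

/-!
# Crux `BirEveryGroundState` (item `stmt-HubbardSuperconductivity-2083`): the crux is settled OUTSIDE the regime map

`Theses.BalabanIR.BirEveryGroundState` (route BalabanIR, crux 5, average → every) quantifies over ALL
data `(δ, U₁, U₂, c)` with `δ ∈ (0,1/2)`, `0 < U₁ < U₂`, `0 < c`; its hypothesis at such a datum is
VERBATIM the window-average body of the target `BirGroundStateAverageLRO`. The target's a-priori side
(`Theorems/BirGroundStateAverageLRO/Negative/*.lean`, standing disprover of item 2079; sorry-free,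
Theses-importing helpers) bounds where that body can hold at all:
Yang's kinematic ceiling `c ≤ 2(1-δ)(1+δ)`, the carrier ceiling `c ≤ 80δ + 640/U₂`, the
weak-coupling ceiling `c ≤ 10⁵·U₁·log²(4 + 32/√U₁)` and the pairing-cost floor
`c/(10⁵·log²(4 + 32/√c)) ≤ U₁` (`birGroundStateAverageLRO_witness_regimeMap`).

Consequences for crux 5, recorded here (first use of the regime map on this item; bookkeeping over
landed theorems, nothing asserts a Theses decl):
* `birEveryGroundState_instance_of_not_regime` — at every datum OUTSIDE the regime map the crux's
  instance holds (vacuously: the window hypothesis is refuted there);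
* `birEveryGroundState_instance_of_lt_floor` / `_of_yang_lt` / `_of_carrier_lt` — the three named
  vacuous regions: windows reaching below the pairing-cost floor, constants above Yang's ceiling,
  windows reaching above the carrier ceiling;
* `avgToEvery_of_lt_floor` — POINTWISE drinker form: at every single coupling
  `0 ≤ U < c/(10⁵·log²(4 + 32/√c))` the implication "average body at `U` ⇒ every-ground-state LRO at
  `U`" holds (its antecedent fails), so the good-coupling set of
  `birEveryGroundState_iff_exists_imp` contains the whole interval `(0, c/(10⁵ log²(4+32/√c)))`;
* `birEveryGroundState_iff_onRegimeMap` — hence `BirEveryGroundState` is EQUIVALENT to its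
  restriction to data inside the regime map: the live residual of crux 5 is confined to
  `c ≤ min(2(1-δ²), 80δ + 640/U₂, 10⁵U₁log²(4+32/√U₁))`, `U₁ ≥ c/(10⁵log²(4+32/√c))`.
Sources: Yang (1962) §3; Bardeen–Cooper–Schrieffer (1957) §II; Tasaki (2020) §2.2. Folklore
finite-dimensional statements; no named facts, no definitions.
-/

noncomputable section

-- the mandated namespace `Summit.<Summit>.<Problem>.Theorems` repeats `HubbardSuperconductivity`
-- (single-problem summit, D-0017), which the `dupNamespace` linter flags on every declaration
set_option linter.dupNamespace false

namespace Summit.HubbardSuperconductivity.HubbardSuperconductivity.Theorems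

open Matrix Finset Filter
open Literature.Probability.LatticeModels Literature.MathematicalPhysics.QuantumLattice
open Summit.HubbardSuperconductivity.HubbardSuperconductivity.Theses.BalabanIR
open Summit.HubbardSuperconductivity.HubbardSuperconductivity.Theorems.BirGroundStateAverageLRO.Negative
open scoped ComplexOrder

/-- **Pointwise drinker form below the pairing-cost floor.** At a single coupling
`0 ≤ U < c/(10⁵·log²(4 + 32/√c))` (`c > 0`, any `δ ≥ -1`) the implication "the crux's average body
holds at `U` eventually in even `L` ⇒ every admissible sector ground-state sequence at `U` has
`d`-wave pair-field LRO" is TRUE, because its antecedent is refuted by the pointwise coupling floor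
`avgBound_coupling_floor_uniform` at a large even side. So every coupling of
`(0, c/(10⁵ log²(4+32/√c)))` is a good coupling in the sense of `birEveryGroundState_iff_exists_imp`.
Bardeen–Cooper–Schrieffer (1957) §II; Tasaki (2020) §2.2. [folklore] -/
theorem avgToEvery_of_lt_floor {δ U c : ℝ} (hδ : -1 ≤ δ) (hU0 : 0 ≤ U) (hc : 0 < c)
    (hUc : U < c / (100000 * Real.log (4 + 32 / Real.sqrt c) ^ 2))
    (h : ∃ L₀ : ℕ, ∀ (L : ℕ) [NeZero L], L₀ ≤ L → Even L →
      let N : ℕ := 2 * ⌊(1 - δ) * (L : ℝ) ^ 2 / 2⌋₊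
      let H := hubbardTorus 2 L 1 U
      let S := szSector (Λ := FermionTorus 2 L) N 0
      let E₀ := S ⊓ Module.End.eigenspace (Matrix.toLin' H) ((H.minEnergyOn S : ℝ) : ℂ)
      let P := projMatrix (E₀.map (Fock.toEuclidean (ι := Orb (FermionTorus 2 L)) :
        Fock (Orb (FermionTorus 2 L)) →ₗ[ℂ] EuclideanSpace ℂ (Finset (Orb (FermionTorus 2 L)))))
      c * (L : ℝ) ^ 4 * P.trace.re ≤
        (P * ((pairField dWaveFormFactor L)ᴴ * pairField dWaveFormFactor L)).trace.re) :
    ∀ (N : ℕ → ℕ) (ψ : ∀ L, Fock (Orb (FermionTorus 2 L))),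
      (∀ L, Even L → N L = 2 * ⌊(1 - δ) * (L : ℝ) ^ 2 / 2⌋₊ ∧ star (ψ L) ⬝ᵥ ψ L = 1 ∧
        IsGroundStateInSector (hubbardTorus 2 L 1 U) (N L) 0 (ψ L)) →
      HasLongRangeOrder (fun k => halfOpenBox 2 (2 * k))
        (fun k => torusPullback (pairFieldCorr dWaveFormFactor ψ) (2 * k)) := by
  intro _ _ _
  exfalso
  obtain ⟨L₀, hL₀⟩ := h
  set m : ℕ := max L₀ (⌈3200 / Real.sqrt c⌉₊ + 3) + 1 with hm
  haveI : NeZero (2 * m) := ⟨by omega⟩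
  have hbound := hL₀ (2 * m) (by omega) (even_two_mul m)
  have hfl := avgBound_coupling_floor_uniform (2 * m) hδ hU0 hc (by omega) hbound
  exact absurd hfl (not_le.mpr hUc)

/-- **Vacuous region I: windows reaching below the pairing-cost floor.** If
`U₁ < c/(10⁵·log²(4 + 32/√c))` then the instance of crux 5 at `(δ, U₁, U₂, c)` holds: the window
hypothesis forces `c/(10⁵·log²(4 + 32/√c)) ≤ U₁` (`birGroundStateAverageLRO_witness_floor_uniform`),
so it is false and anything follows. Bardeen–Cooper–Schrieffer (1957) §II. [folklore] -/
theorem birEveryGroundState_instance_of_lt_floor {δ U₁ U₂ c : ℝ}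
    (hδ : δ ∈ Set.Ioo (0:ℝ) (1/2)) (hU₁ : 0 < U₁) (hU : U₁ < U₂) (hc : 0 < c)
    (hfl : U₁ < c / (100000 * Real.log (4 + 32 / Real.sqrt c) ^ 2))
    (h : ∀ U ∈ Set.Ioo U₁ U₂, ∃ L₀ : ℕ, ∀ (L : ℕ) [NeZero L], L₀ ≤ L → Even L →
      let N : ℕ := 2 * ⌊(1 - δ) * (L : ℝ) ^ 2 / 2⌋₊
      let H := hubbardTorus 2 L 1 U
      let S := szSector (Λ := FermionTorus 2 L) N 0
      let E₀ := S ⊓ Module.End.eigenspace (Matrix.toLin' H) ((H.minEnergyOn S : ℝ) : ℂ)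
      let P := projMatrix (E₀.map (Fock.toEuclidean (ι := Orb (FermionTorus 2 L)) :
        Fock (Orb (FermionTorus 2 L)) →ₗ[ℂ] EuclideanSpace ℂ (Finset (Orb (FermionTorus 2 L)))))
      c * (L : ℝ) ^ 4 * P.trace.re ≤
        (P * ((pairField dWaveFormFactor L)ᴴ * pairField dWaveFormFactor L)).trace.re) :
    ∃ U ∈ Set.Ioo U₁ U₂, ∀ (N : ℕ → ℕ) (ψ : ∀ L, Fock (Orb (FermionTorus 2 L))),
      (∀ L, Even L → N L = 2 * ⌊(1 - δ) * (L : ℝ) ^ 2 / 2⌋₊ ∧ star (ψ L) ⬝ᵥ ψ L = 1 ∧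
        IsGroundStateInSector (hubbardTorus 2 L 1 U) (N L) 0 (ψ L)) →
      HasLongRangeOrder (fun k => halfOpenBox 2 (2 * k))
        (fun k => torusPullback (pairFieldCorr dWaveFormFactor ψ) (2 * k)) :=
  absurd (birGroundStateAverageLRO_witness_floor_uniform hδ hU₁ hU hc h) (not_le.mpr hfl)

/-- **Vacuous region II: constants above Yang's kinematic ceiling.** If `2(1-δ)(1+δ) < c` then the
instance of crux 5 at `(δ, U₁, U₂, c)` holds: the window hypothesis forces `c ≤ 2(1-δ)(1+δ)`
(`birGroundStateAverageLRO_witness_const_le_yang`). Yang (1962) §3. [folklore] -/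
theorem birEveryGroundState_instance_of_yang_lt {δ U₁ U₂ c : ℝ}
    (hδ : δ ∈ Set.Ioo (0:ℝ) (1/2)) (hU : U₁ < U₂) (hy : 2 * (1 - δ) * (1 + δ) < c)
    (h : ∀ U ∈ Set.Ioo U₁ U₂, ∃ L₀ : ℕ, ∀ (L : ℕ) [NeZero L], L₀ ≤ L → Even L →
      let N : ℕ := 2 * ⌊(1 - δ) * (L : ℝ) ^ 2 / 2⌋₊
      let H := hubbardTorus 2 L 1 U
      let S := szSector (Λ := FermionTorus 2 L) N 0
      let E₀ := S ⊓ Module.End.eigenspace (Matrix.toLin' H) ((H.minEnergyOn S : ℝ) : ℂ)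
      let P := projMatrix (E₀.map (Fock.toEuclidean (ι := Orb (FermionTorus 2 L)) :
        Fock (Orb (FermionTorus 2 L)) →ₗ[ℂ] EuclideanSpace ℂ (Finset (Orb (FermionTorus 2 L)))))
      c * (L : ℝ) ^ 4 * P.trace.re ≤
        (P * ((pairField dWaveFormFactor L)ᴴ * pairField dWaveFormFactor L)).trace.re) :
    ∃ U ∈ Set.Ioo U₁ U₂, ∀ (N : ℕ → ℕ) (ψ : ∀ L, Fock (Orb (FermionTorus 2 L))),
      (∀ L, Even L → N L = 2 * ⌊(1 - δ) * (L : ℝ) ^ 2 / 2⌋₊ ∧ star (ψ L) ⬝ᵥ ψ L = 1 ∧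
        IsGroundStateInSector (hubbardTorus 2 L 1 U) (N L) 0 (ψ L)) →
      HasLongRangeOrder (fun k => halfOpenBox 2 (2 * k))
        (fun k => torusPullback (pairFieldCorr dWaveFormFactor ψ) (2 * k)) :=
  absurd (birGroundStateAverageLRO_witness_const_le_yang hδ hU h) (not_le.mpr hy)

/-- **Vacuous region III: windows reaching above the carrier ceiling.** If `80δ + 640/U₂ < c` then the
instance of crux 5 at `(δ, U₁, U₂, c)` holds: the window hypothesis forces `c ≤ 80δ + 640/U₂`
(`birGroundStateAverageLRO_witness_const_le_carrier_upper`). Zhang–Gross–Rice–Shiba (1988) §2;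
Yang (1962) §3. [folklore] -/
theorem birEveryGroundState_instance_of_carrier_lt {δ U₁ U₂ c : ℝ}
    (hδ : δ ∈ Set.Ioo (0:ℝ) (1/2)) (hU₁ : 0 < U₁) (hU : U₁ < U₂) (hcar : 80 * δ + 640 / U₂ < c)
    (h : ∀ U ∈ Set.Ioo U₁ U₂, ∃ L₀ : ℕ, ∀ (L : ℕ) [NeZero L], L₀ ≤ L → Even L →
      let N : ℕ := 2 * ⌊(1 - δ) * (L : ℝ) ^ 2 / 2⌋₊
      let H := hubbardTorus 2 L 1 U
      let S := szSector (Λ := FermionTorus 2 L) N 0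
      let E₀ := S ⊓ Module.End.eigenspace (Matrix.toLin' H) ((H.minEnergyOn S : ℝ) : ℂ)
      let P := projMatrix (E₀.map (Fock.toEuclidean (ι := Orb (FermionTorus 2 L)) :
        Fock (Orb (FermionTorus 2 L)) →ₗ[ℂ] EuclideanSpace ℂ (Finset (Orb (FermionTorus 2 L)))))
      c * (L : ℝ) ^ 4 * P.trace.re ≤
        (P * ((pairField dWaveFormFactor L)ᴴ * pairField dWaveFormFactor L)).trace.re) :
    ∃ U ∈ Set.Ioo U₁ U₂, ∀ (N : ℕ → ℕ) (ψ : ∀ L, Fock (Orb (FermionTorus 2 L))),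
      (∀ L, Even L → N L = 2 * ⌊(1 - δ) * (L : ℝ) ^ 2 / 2⌋₊ ∧ star (ψ L) ⬝ᵥ ψ L = 1 ∧
        IsGroundStateInSector (hubbardTorus 2 L 1 U) (N L) 0 (ψ L)) →
      HasLongRangeOrder (fun k => halfOpenBox 2 (2 * k))
        (fun k => torusPullback (pairFieldCorr dWaveFormFactor ψ) (2 * k)) :=
  absurd (birGroundStateAverageLRO_witness_const_le_carrier_upper hδ hU₁ hU h) (not_le.mpr hcar)

/-- **Crux 5 is settled outside the regime map.** At every datum `(δ, U₁, U₂, c)` violating one of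
the four regime-map inequalities (Yang, carrier, weak-coupling ceiling, pairing-cost floor) the
instance of `BirEveryGroundState` holds, by `birGroundStateAverageLRO_witness_regimeMap`.
Yang (1962) §3; Bardeen–Cooper–Schrieffer (1957) §II. [folklore] -/
theorem birEveryGroundState_instance_of_not_regime {δ U₁ U₂ c : ℝ}
    (hδ : δ ∈ Set.Ioo (0:ℝ) (1/2)) (hU₁ : 0 < U₁) (hU : U₁ < U₂) (hc : 0 < c)
    (hout : ¬ (c ≤ 2 * (1 - δ) * (1 + δ) ∧ c ≤ 80 * δ + 640 / U₂ ∧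
      c ≤ 100000 * U₁ * Real.log (4 + 32 / Real.sqrt U₁) ^ 2 ∧
      c / (100000 * Real.log (4 + 32 / Real.sqrt c) ^ 2) ≤ U₁))
    (h : ∀ U ∈ Set.Ioo U₁ U₂, ∃ L₀ : ℕ, ∀ (L : ℕ) [NeZero L], L₀ ≤ L → Even L →
      let N : ℕ := 2 * ⌊(1 - δ) * (L : ℝ) ^ 2 / 2⌋₊
      let H := hubbardTorus 2 L 1 U
      let S := szSector (Λ := FermionTorus 2 L) N 0
      let E₀ := S ⊓ Module.End.eigenspace (Matrix.toLin' H) ((H.minEnergyOn S : ℝ) : ℂ)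
      let P := projMatrix (E₀.map (Fock.toEuclidean (ι := Orb (FermionTorus 2 L)) :
        Fock (Orb (FermionTorus 2 L)) →ₗ[ℂ] EuclideanSpace ℂ (Finset (Orb (FermionTorus 2 L)))))
      c * (L : ℝ) ^ 4 * P.trace.re ≤
        (P * ((pairField dWaveFormFactor L)ᴴ * pairField dWaveFormFactor L)).trace.re) :
    ∃ U ∈ Set.Ioo U₁ U₂, ∀ (N : ℕ → ℕ) (ψ : ∀ L, Fock (Orb (FermionTorus 2 L))),
      (∀ L, Even L → N L = 2 * ⌊(1 - δ) * (L : ℝ) ^ 2 / 2⌋₊ ∧ star (ψ L) ⬝ᵥ ψ L = 1 ∧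
        IsGroundStateInSector (hubbardTorus 2 L 1 U) (N L) 0 (ψ L)) →
      HasLongRangeOrder (fun k => halfOpenBox 2 (2 * k))
        (fun k => torusPullback (pairFieldCorr dWaveFormFactor ψ) (2 * k)) :=
  absurd (birGroundStateAverageLRO_witness_regimeMap hδ hU₁ hU hc h) hout

/-- **`BirEveryGroundState` ⇔ its restriction to the regime map.** The crux holds if and only if it
holds at the data `(δ, U₁, U₂, c)` satisfying all four regime-map inequalities
`c ≤ 2(1-δ)(1+δ)`, `c ≤ 80δ + 640/U₂`, `c ≤ 10⁵·U₁·log²(4 + 32/√U₁)`, `c/(10⁵·log²(4 + 32/√c)) ≤ U₁`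
(outside, `birEveryGroundState_instance_of_not_regime` settles it). The live residual of crux 5 is
therefore confined to the bounded-`c`, floor-bounded-`U₁` region of the target's regime map.
Yang (1962) §3; Bardeen–Cooper–Schrieffer (1957) §II. [folklore] -/
theorem birEveryGroundState_iff_onRegimeMap : BirEveryGroundState ↔ ∀ (δ U₁ U₂ c : ℝ), δ ∈ Set.Ioo (0:ℝ) (1/2) → 0 < U₁ → U₁ < U₂ → 0 < c → (c ≤ 2 * (1 - δ) * (1 + δ) ∧ c ≤ 80 * δ + 640 / U₂ ∧ c ≤ 100000 * U₁ * Real.log (4 + 32 / Real.sqrt U₁) ^ 2 ∧ c / (100000 * Real.log (4 + 32 / Real.sqrt c) ^ 2) ≤ U₁) → (∀ U ∈ Set.Ioo U₁ U₂, ∃ L₀ : ℕ, ∀ (L : ℕ) [NeZero L], L₀ ≤ L → Even L → let N : ℕ := 2 * ⌊(1 - δ) * (L : ℝ) ^ 2 / 2⌋₊; let H := hubbardTorus 2 L 1 U; let S := szSector (Λ := FermionTorus 2 L) N 0; let E₀ := S ⊓ Module.End.eigenspace (Matrix.toLin' H) ((H.minEnergyOn S : ℝ) : ℂ); let P := projMatrix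 (E₀.map (Fock.toEuclidean (ι := Orb (FermionTorus 2 L)) : Fock (Orb (FermionTorus 2 L)) →ₗ[ℂ] EuclideanSpace ℂ (Finset (Orb (FermionTorus 2 L))))); c * (L : ℝ) ^ 4 * P.trace.re ≤ (P * ((pairField dWaveFormFactor L)ᴴ * pairField dWaveFormFactor L)).trace.re) → ∃ U ∈ Set.Ioo U₁ U₂, ∀ (N : ℕ → ℕ) (ψ : ∀ L, Fock (Orb (FermionTorus 2 L))), (∀ L, Even L → N L = 2 * ⌊(1 - δ) * (L : ℝ) ^ 2 / 2⌋₊ ∧ star (ψ L) ⬝ᵥ ψ L = 1 ∧ IsGroundStateInSector (hubbardTorus 2 L 1 U) (N L) 0 (ψ L)) → HasLongRangeOrder (fun k => halfOpenBox 2 (2 * k)) (fun k => torusPullback (pairFieldCorr dWaveFormFactor ψ) (2 * k)) := by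
  constructor
  · intro hT δ U₁ U₂ c hδ hU₁ hU hc _ h
    exact hT δ U₁ U₂ c hδ hU₁ hU hc h
  · intro hR δ U₁ U₂ c hδ hU₁ hU hc h
    by_cases hreg : c ≤ 2 * (1 - δ) * (1 + δ) ∧ c ≤ 80 * δ + 640 / U₂ ∧
        c ≤ 100000 * U₁ * Real.log (4 + 32 / Real.sqrt U₁) ^ 2 ∧
        c / (100000 * Real.log (4 + 32 / Real.sqrt c) ^ 2) ≤ U₁
    · exact hR δ U₁ U₂ c hδ hU₁ hU hc hreg h
    · exact birEveryGroundState_instance_of_not_regime hδ hU₁ hU hc hreg h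

/-! ### Pointwise good couplings above the two ceilings (appended, lead c7)

The drinker form of the crux (`birEveryGroundState_iff_exists_imp`) asks for ONE good coupling per
window; `avgToEvery_of_lt_floor` gives every coupling below the pairing-cost floor. The two pointwise
ceilings of the target's a-priori side (`avgBound_const_le_carrier`, `avgBound_const_le_yang`, each
with an `O(1/L²)` finite-size term) give, after an Archimedean choice of the side, every coupling
above the carrier ceiling and — for constants above Yang's ceiling — every coupling whatsoever. -/

/-- **Pointwise drinker form above the carrier ceiling.** At a single coupling `U > 0` with
`80δ + 640/U < c` (`δ ∈ [0,1]`) the implication "the crux's average body holds at `U` eventually in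
even `L` ⇒ every admissible sector ground-state sequence at `U` has `d`-wave pair-field LRO" is TRUE:
its antecedent contradicts the pointwise carrier ceiling `c ≤ 80δ + 640/U + 400/L²`
(`avgBound_const_le_carrier`) at an even side `L > 400/(c - 80δ - 640/U)`. So every coupling of
`{U > 0 : 80δ + 640/U < c}` is a good coupling. Zhang–Gross–Rice–Shiba (1988) §2; Yang (1962) §3.
[folklore] -/
theorem avgToEvery_of_carrier_lt {δ U c : ℝ} (hδ0 : 0 ≤ δ) (hδ1 : δ ≤ 1) (hU : 0 < U) (hcar : 80 * δ + 640 / U < c) (h : ∃ L₀ : ℕ, ∀ (L : ℕ) [NeZero L], L₀ ≤ L → Even L → let N : ℕ := 2 * ⌊(1 - δ) * (L : ℝ) ^ 2 / 2⌋₊; let H := hubbardTorus 2 L 1 U; let S := szSector (Λ := FermionTorus 2 L) N 0; let E₀ := S ⊓ Module.End.eigenspace (Matrix.toLin' H) ((H.minEnergyOn S : ℝ) : ℂ); let P := projMatrix (E₀.map (Fock.toEuclidean (ι := Orb (FermionTorus 2 L)) : Fock (Orb (FermionTorus 2 L)) →ₗ[ℂ] EuclideanSpace ℂ (Finset (Orb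 (FermionTorus 2 L))))); c * (L : ℝ) ^ 4 * P.trace.re ≤ (P * ((pairField dWaveFormFactor L)ᴴ * pairField dWaveFormFactor L)).trace.re) : ∀ (N : ℕ → ℕ) (ψ : ∀ L, Fock (Orb (FermionTorus 2 L))), (∀ L, Even L → N L = 2 * ⌊(1 - δ) * (L : ℝ) ^ 2 / 2⌋₊ ∧ star (ψ L) ⬝ᵥ ψ L = 1 ∧ IsGroundStateInSector (hubbardTorus 2 L 1 U) (N L) 0 (ψ L)) → HasLongRangeOrder (fun k => halfOpenBox 2 (2 * k)) (fun k => torusPullback (pairFieldCorr dWaveFormFactor ψ) (2 * k)) := by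
  intro _ _ _
  exfalso
  obtain ⟨L₀, hL₀⟩ := h
  set ε : ℝ := c - (80 * δ + 640 / U) with hε
  have hεpos : 0 < ε := by rw [hε]; linarith
  obtain ⟨n, hn⟩ := exists_nat_gt (400 / ε)
  set m : ℕ := max L₀ (max n 3) + 1 with hm
  haveI : NeZero (2 * m) := ⟨by omega⟩
  have hbound := hL₀ (2 * m) (by omega) (even_two_mul m)
  have hle := avgBound_const_le_carrier (2 * m) (by omega) hδ0 hδ1 hU hbound
  have hLn : (n : ℝ) ≤ ((2 * m : ℕ) : ℝ) := by exact_mod_cast (show n ≤ 2 * m by omega)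
  have hL1 : (1 : ℝ) ≤ ((2 * m : ℕ) : ℝ) := by exact_mod_cast (show 1 ≤ 2 * m by omega)
  have hLpos : (0 : ℝ) < ((2 * m : ℕ) : ℝ) := by linarith
  have hεL : 400 / ε < ((2 * m : ℕ) : ℝ) := lt_of_lt_of_le hn hLn
  have h400 : 400 < ((2 * m : ℕ) : ℝ) * ε := by
    have := (div_lt_iff₀ hεpos).mp hεL
    linarith
  have hsq : ((2 * m : ℕ) : ℝ) ≤ ((2 * m : ℕ) : ℝ) ^ 2 := by nlinarith
  have hdiv1 : 400 / ((2 * m : ℕ) : ℝ) ^ 2 ≤ 400 / ((2 * m : ℕ) : ℝ) :=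
    div_le_div_of_nonneg_left (by norm_num) hLpos hsq
  have hdiv2 : 400 / ((2 * m : ℕ) : ℝ) < ε := by
    rw [div_lt_iff₀ hLpos]
    linarith
  have : c ≤ 80 * δ + 640 / U + 400 / ((2 * m : ℕ) : ℝ) ^ 2 := hle
  linarith

/-- **Pointwise drinker form above Yang's ceiling.** If `2(1-δ)(1+δ) < c` (`δ ∈ [0,1]`) then at
EVERY coupling `U` the implication "the crux's average body holds at `U` eventually in even `L` ⇒
every admissible sector ground-state sequence at `U` has `d`-wave pair-field LRO" is TRUE: its
antecedent contradicts the pointwise kinematic ceiling `c ≤ 2(1-δ)(1+δ) + 4(1-δ)/L²`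
(`avgBound_const_le_yang`) at an even side `L > 4/(c - 2(1-δ)(1+δ))`. Yang (1962) §3. [folklore] -/
theorem avgToEvery_of_yang_lt {δ U c : ℝ} (hδ0 : 0 ≤ δ) (hδ1 : δ ≤ 1)
    (hy : 2 * (1 - δ) * (1 + δ) < c)
    (h : ∃ L₀ : ℕ, ∀ (L : ℕ) [NeZero L], L₀ ≤ L → Even L →
      let N : ℕ := 2 * ⌊(1 - δ) * (L : ℝ) ^ 2 / 2⌋₊
      let H := hubbardTorus 2 L 1 U
      let S := szSector (Λ := FermionTorus 2 L) N 0
      let E₀ := S ⊓ Module.End.eigenspace (Matrix.toLin' H) ((H.minEnergyOn S : ℝ) : ℂ)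
      let P := projMatrix (E₀.map (Fock.toEuclidean (ι := Orb (FermionTorus 2 L)) :
        Fock (Orb (FermionTorus 2 L)) →ₗ[ℂ] EuclideanSpace ℂ (Finset (Orb (FermionTorus 2 L)))))
      c * (L : ℝ) ^ 4 * P.trace.re ≤
        (P * ((pairField dWaveFormFactor L)ᴴ * pairField dWaveFormFactor L)).trace.re) :
    ∀ (N : ℕ → ℕ) (ψ : ∀ L, Fock (Orb (FermionTorus 2 L))),
      (∀ L, Even L → N L = 2 * ⌊(1 - δ) * (L : ℝ) ^ 2 / 2⌋₊ ∧ star (ψ L) ⬝ᵥ ψ L = 1 ∧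
        IsGroundStateInSector (hubbardTorus 2 L 1 U) (N L) 0 (ψ L)) →
      HasLongRangeOrder (fun k => halfOpenBox 2 (2 * k))
        (fun k => torusPullback (pairFieldCorr dWaveFormFactor ψ) (2 * k)) := by
  intro _ _ _
  exfalso
  obtain ⟨L₀, hL₀⟩ := h
  set ε : ℝ := c - 2 * (1 - δ) * (1 + δ) with hε
  have hεpos : 0 < ε := by rw [hε]; linarith
  obtain ⟨n, hn⟩ := exists_nat_gt (4 / ε)
  set m : ℕ := max L₀ (max n 3) + 1 with hm
  haveI : NeZero (2 * m) := ⟨by omega⟩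
  have hbound := hL₀ (2 * m) (by omega) (even_two_mul m)
  have hle := avgBound_const_le_yang (2 * m) (by omega) hδ0 hδ1 hbound
  have hLn : (n : ℝ) ≤ ((2 * m : ℕ) : ℝ) := by exact_mod_cast (show n ≤ 2 * m by omega)
  have hL1 : (1 : ℝ) ≤ ((2 * m : ℕ) : ℝ) := by exact_mod_cast (show 1 ≤ 2 * m by omega)
  have hLpos : (0 : ℝ) < ((2 * m : ℕ) : ℝ) := by linarith
  have hεL : 4 / ε < ((2 * m : ℕ) : ℝ) := lt_of_lt_of_le hn hLn
  have h4 : 4 < ((2 * m : ℕ) : ℝ) * ε := by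
    have := (div_lt_iff₀ hεpos).mp hεL
    linarith
  have hsq : ((2 * m : ℕ) : ℝ) ≤ ((2 * m : ℕ) : ℝ) ^ 2 := by nlinarith
  have hnum : 4 * (1 - δ) ≤ 4 := by linarith
  have hdiv0 : 4 * (1 - δ) / ((2 * m : ℕ) : ℝ) ^ 2 ≤ 4 / ((2 * m : ℕ) : ℝ) ^ 2 :=
    div_le_div_of_nonneg_right hnum (by positivity)
  have hdiv1 : 4 / ((2 * m : ℕ) : ℝ) ^ 2 ≤ 4 / ((2 * m : ℕ) : ℝ) :=
    div_le_div_of_nonneg_left (by norm_num) hLpos hsq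
  have hdiv2 : 4 / ((2 * m : ℕ) : ℝ) < ε := by
    rw [div_lt_iff₀ hLpos]
    linarith
  have : c ≤ 2 * (1 - δ) * (1 + δ) + 4 * (1 - δ) / ((2 * m : ℕ) : ℝ) ^ 2 := hle
  linarith

end Summit.HubbardSuperconductivity.HubbardSuperconductivity.Theorems
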